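import Mathlib.Algebra.BigOperators.Group.Multiset.Basic
import Mathlib.Algebra.Order.BigOperators.Group.Multiset
import Mathlib.GroupTheory.Perm.Basic
import Mathlib.Tactic.Linarith
import Mathlib.Tactic.Ring
import HarnessLib

/-!
# Henniart 2002, Thm 1.7 (a): the counting argument, part 1 — differences of the probe counts (§4.2)

Helper file of line `PhantomRMJunctionOfPieces` (crux stmt-Langlands-13643 `PhantomRMYoshida.PhantomRMJunction`),
registered stub F3d `stub_isEquivalent_of_finrank_homWD_stringModel_eq` (Henniart 2002 Thm 1.7 (a) in `Hom` form).

Abstract setting.  `K` is a type of "labels" (in the application: isomorphism classes of irreducible continuous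
representations of `W_F`), `T : Equiv.Perm K` the unramified twist `ρ ↦ ρ ⊗ ‖·‖` acting FREELY
(`(T ^ j) k ≠ k` for `j > 0` — no self-twist), `d : K → ℕ` a `T`-invariant "dimension".  A Frobenius-semisimple
Weil–Deligne representation is recorded by its multiset `S` of strings `(k, b)` = `k ⊗ Sp(b)` (head `k`, length
`b ≥ 1`, slots `k, T k, …, T^{b-1} k`, top slot `T^{b-1} k`).  The number `dim Hom_WD(c ⊗ Sp(a), σ)` is the
number of strings of `σ` having `c` among their top `min(a, b)` slots:
`S.countP (fun p => ∃ j, j < p.2 ∧ p.2 ≤ j + a ∧ (T ^ j) p.1 = c)`.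

This part: freeness bookkeeping (`pow_apply_injective`), the first difference of the counts in `a` (Henniart's `w`,
`countP_topSlots_succ`: strings of length `≥ a + 1` whose `(a+1)`-st slot from the top is `c`), the second
difference (`countP_slot_eq_count_add`: multiplicity of the string `(k', a)`), and the transfer of equalities of
counts up to a budget `P` to multiplicities of strings `(k', a)` with `(a + 1) · d k' ≤ P` (`count_eq_of_hh`).
Part 2 (`…StringCounting`) finishes the reconstruction.  Pure combinatorics (Mathlib only); no definitions;
standard axioms only.
-/

noncomputable section

set_option linter.dupNamespace false

open scoped Classical
open Multiset

namespace Summit.Langlands.Langlands.Theorems.PhantomRMJunctionOfPieces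

variable {K : Type*} (T : Equiv.Perm K) (d : K → ℕ)

/-! ## Free twisting -/

/-- Under a free twist, `j ↦ T^j k` is injective. [cite: HenniartBSMF2002, §4.2] -/
theorem pow_apply_injective (hfree : ∀ (k : K) (j : ℕ), 0 < j → (T ^ j) k ≠ k) (k : K) {i j : ℕ}
    (h : (T ^ i) k = (T ^ j) k) : i = j := by
  by_contra hne
  rcases Nat.lt_or_gt_of_ne hne with hlt | hlt
  · have hj : T ^ j = T ^ (j - i) * T ^ i := by rw [← pow_add, Nat.sub_add_cancel hlt.le]
    rw [hj, Equiv.Perm.mul_apply] at h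
    exact hfree ((T ^ i) k) (j - i) (Nat.sub_pos_of_lt hlt) h.symm
  · have hi : T ^ i = T ^ (i - j) * T ^ j := by rw [← pow_add, Nat.sub_add_cancel hlt.le]
    rw [hi, Equiv.Perm.mul_apply] at h
    exact hfree ((T ^ j) k) (i - j) (Nat.sub_pos_of_lt hlt) h

/-- `d` is invariant under all powers of the twist. [folklore] -/
theorem d_pow_apply (hd : ∀ k, d (T k) = d k) (j : ℕ) (k : K) : d ((T ^ j) k) = d k := by
  induction j with
  | zero => simp
  | succ j ih => rw [pow_succ', Equiv.Perm.mul_apply, hd, ih]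

/-! ## Counting with disjoint predicates -/

/-- `countP` of a disjoint disjunction is the sum of the `countP`s (any decidability instances). [folklore] -/
theorem countP_or_of_disjoint {α : Type*} (S : Multiset α) (A B : α → Prop) [DecidablePred A] [DecidablePred B]
    [DecidablePred fun x => A x ∨ B x] (h : ∀ x ∈ S, ¬ (A x ∧ B x)) :
    S.countP (fun x => A x ∨ B x) = S.countP A + S.countP B := by
  induction S using Multiset.induction_on with
  | empty => simp
  | cons x S ih =>
    have hx := h x (Multiset.mem_cons_self x S)
    rw [Multiset.countP_cons, Multiset.countP_cons, Multiset.countP_cons,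
      ih fun y hy => h y (Multiset.mem_cons_of_mem hy)]
    by_cases hA : A x
    · have hB : ¬ B x := fun hB => hx ⟨hA, hB⟩
      rw [if_pos (Or.inl hA), if_pos hA, if_neg hB]
      omega
    · by_cases hB : B x
      · rw [if_pos (Or.inr hB), if_neg hA, if_pos hB]
        omega
      · rw [if_neg (by tauto), if_neg hA, if_neg hB]
        omega

/-! ## The probe counts: first and second differences -/

/-- No string has a slot among its top `0` slots. [folklore] -/
theorem countP_topSlots_zero (S : Multiset (K × ℕ)) (c : K) :
    S.countP (fun p => ∃ j : ℕ, j < p.2 ∧ p.2 ≤ j + 0 ∧ (T ^ j) p.1 = c) = 0 :=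
  Multiset.countP_eq_zero.mpr fun p _ ⟨j, hj, hj', _⟩ => by omega

/-- **First difference** (Henniart's `w`): the strings with `c` among the top `a + 1` slots are those with `c`
among the top `a` slots together with (disjointly, by freeness) those of length `≥ a + 1` whose `(a+1)`-st slot
from the top is `c`. [cite: HenniartBSMF2002, §4.2] -/
theorem countP_topSlots_succ (hfree : ∀ (k : K) (j : ℕ), 0 < j → (T ^ j) k ≠ k) (S : Multiset (K × ℕ))
    (c : K) (a : ℕ) :
    S.countP (fun p => ∃ j : ℕ, j < p.2 ∧ p.2 ≤ j + (a + 1) ∧ (T ^ j) p.1 = c) =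
      S.countP (fun p => ∃ j : ℕ, j < p.2 ∧ p.2 ≤ j + a ∧ (T ^ j) p.1 = c) +
        S.countP (fun p => a + 1 ≤ p.2 ∧ (T ^ (p.2 - (a + 1))) p.1 = c) := by
  rw [← countP_or_of_disjoint]
  · refine Multiset.countP_congr rfl fun p _ => ?_
    simp only [eq_iff_iff]
    constructor
    · rintro ⟨j, hj, hja, hjc⟩
      by_cases hle : p.2 ≤ j + a
      · exact Or.inl ⟨j, hj, hle, hjc⟩
      · right
        refine ⟨by omega, ?_⟩
        have : p.2 - (a + 1) = j := by omega
        rw [this, hjc]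
    · rintro (⟨j, hj, hja, hjc⟩ | ⟨ha, hc⟩)
      · exact ⟨j, hj, by omega, hjc⟩
      · exact ⟨p.2 - (a + 1), by omega, by omega, hc⟩
  · rintro p - ⟨⟨j, hj, hja, hjc⟩, ha, hc⟩
    have := pow_apply_injective T hfree p.1 (hjc.trans hc.symm)
    omega

/-- **Second difference**: the strings of length `≥ a` whose `a`-th slot from the top is `k'` are the copies
of `(k', a)` together with (disjointly) the strings of length `≥ a + 1` whose `(a+1)`-st slot from the top is
`T⁻¹ k'`. [cite: HenniartBSMF2002, §4.2] -/
theorem countP_slot_eq_count_add (S : Multiset (K × ℕ)) (k' : K) (a : ℕ) :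
    S.countP (fun p => a ≤ p.2 ∧ (T ^ (p.2 - a)) p.1 = k') =
      S.count (k', a) + S.countP (fun p => a + 1 ≤ p.2 ∧ (T ^ (p.2 - (a + 1))) p.1 = T.symm k') := by
  rw [Multiset.count, ← countP_or_of_disjoint]
  · refine Multiset.countP_congr rfl fun p _ => ?_
    simp only [eq_iff_iff]
    constructor
    · rintro ⟨ha, hk⟩
      rcases Nat.eq_or_lt_of_le ha with rfl | hlt
      · left
        simp only [Nat.sub_self, pow_zero, Equiv.Perm.one_apply] at hk
        exact Prod.ext hk.symm rfl
      · right
        refine ⟨hlt, ?_⟩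
        have h1 : p.2 - a = (p.2 - (a + 1)) + 1 := by omega
        rw [h1, pow_succ', Equiv.Perm.mul_apply] at hk
        rw [← hk, Equiv.symm_apply_apply]
    · rintro (hp | ⟨ha, hk⟩)
      · subst hp
        exact ⟨le_rfl, by simp⟩
      · refine ⟨by omega, ?_⟩
        have h1 : p.2 - a = (p.2 - (a + 1)) + 1 := by omega
        rw [h1, pow_succ', Equiv.Perm.mul_apply, hk, Equiv.apply_symm_apply]
  · rintro p - ⟨hp, ha, -⟩
    subst hp
    simp at ha

/-! ## Transfer of equalities of counts -/

section Transfer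

variable {T d}
variable (hd : ∀ k, d (T k) = d k) (hfree : ∀ (k : K) (j : ℕ), 0 < j → (T ^ j) k ≠ k) (P : ℕ)
  {S S' : Multiset (K × ℕ)}
  (hh : ∀ (c : K) (a : ℕ), 0 < a → a * d c ≤ P →
    S.countP (fun p => ∃ j : ℕ, j < p.2 ∧ p.2 ≤ j + a ∧ (T ^ j) p.1 = c) =
    S'.countP (fun p => ∃ j : ℕ, j < p.2 ∧ p.2 ≤ j + a ∧ (T ^ j) p.1 = c))
include hfree hh

/-- Equality of the probe counts up to budget `P` passes to the first differences: for `(a+1) · d c ≤ P` the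
numbers of strings of length `≥ a + 1` with `(a+1)`-st slot from the top equal to `c` agree.
[cite: HenniartBSMF2002, §4.2] -/
theorem countP_slot_eq_of_hh (c : K) (a : ℕ) (hP : (a + 1) * d c ≤ P) :
    S.countP (fun p => a + 1 ≤ p.2 ∧ (T ^ (p.2 - (a + 1))) p.1 = c) =
      S'.countP (fun p => a + 1 ≤ p.2 ∧ (T ^ (p.2 - (a + 1))) p.1 = c) := by
  have h1 := countP_topSlots_succ T hfree S c a
  have h2 := countP_topSlots_succ T hfree S' c a
  have e1 := hh c (a + 1) (Nat.succ_pos a) hP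
  have e0 : S.countP (fun p => ∃ j : ℕ, j < p.2 ∧ p.2 ≤ j + a ∧ (T ^ j) p.1 = c) =
      S'.countP (fun p => ∃ j : ℕ, j < p.2 ∧ p.2 ≤ j + a ∧ (T ^ j) p.1 = c) := by
    rcases Nat.eq_zero_or_pos a with h0 | ha
    · subst h0
      rw [countP_topSlots_zero, countP_topSlots_zero]
    · exact hh c a ha (le_trans (Nat.mul_le_mul_right _ (Nat.le_succ a)) hP)
  omega

include hd in
/-- Equality of the probe counts up to budget `P` passes to the multiplicities of the strings `(k', a)` with
`a ≥ 1` and `(a + 1) · d k' ≤ P` (second differences). [cite: HenniartBSMF2002, §4.2] -/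
theorem count_eq_of_hh (k' : K) (a : ℕ) (ha : 0 < a) (hP : (a + 1) * d k' ≤ P) :
    S.count (k', a) = S'.count (k', a) := by
  obtain ⟨a₀, rfl⟩ : ∃ a₀, a = a₀ + 1 := ⟨a - 1, by omega⟩
  have h1 := countP_slot_eq_count_add T S k' (a₀ + 1)
  have h2 := countP_slot_eq_count_add T S' k' (a₀ + 1)
  have e1 : S.countP (fun p => a₀ + 1 ≤ p.2 ∧ (T ^ (p.2 - (a₀ + 1))) p.1 = k') =
      S'.countP (fun p => a₀ + 1 ≤ p.2 ∧ (T ^ (p.2 - (a₀ + 1))) p.1 = k') :=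
    countP_slot_eq_of_hh hfree P hh k' a₀ (le_trans (Nat.mul_le_mul_right _ (Nat.le_succ _)) hP)
  have hdT : d (T.symm k') = d k' := by
    conv_rhs => rw [← Equiv.apply_symm_apply T k', hd]
  have e2 : S.countP (fun p => a₀ + 1 + 1 ≤ p.2 ∧ (T ^ (p.2 - (a₀ + 1 + 1))) p.1 = T.symm k') =
      S'.countP (fun p => a₀ + 1 + 1 ≤ p.2 ∧ (T ^ (p.2 - (a₀ + 1 + 1))) p.1 = T.symm k') :=
    countP_slot_eq_of_hh hfree P hh (T.symm k') (a₀ + 1) (by rw [hdT]; exact hP)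
  omega

end Transfer

/-- **Registered sub-goal (part 1 of the counting argument)**: equality of the probe counts up to budget `P` forces
equal multiplicities of every string `(k', a)` with `a ≥ 1` and `(a + 1) · d k' ≤ P` (Henniart's second differences).
[cite: HenniartBSMF2002, §4.2] -/
theorem stub_count_eq_of_hh : ∀ (K : Type) (T : Equiv.Perm K) (d : K → ℕ), (∀ k, d (T k) = d k) → (∀ (k : K) (j : ℕ), 0 < j → (T ^ j) k ≠ k) → ∀ (P : ℕ) (S S' : Multiset (K × ℕ)), (∀ (c : K) (a : ℕ), 0 < a → a * d c ≤ P → S.countP (fun p => ∃ j : ℕ, j < p.2 ∧ p.2 ≤ j + a ∧ (T ^ j) p.1 = c) = S'.countP (fun p => ∃ j : ℕ, j < p.2 ∧ p.2 ≤ j + a ∧ (T ^ j) p.1 = c)) → ∀ (k' : K) (a : ℕ), 0 < a → (a + 1) * d k' ≤ P → S.count (k', a) = S'.count (k', a) :=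
  fun _ _ _ hd hfree P _ _ hh k' a ha hP => count_eq_of_hh hd hfree P hh k' a ha hP

end Summit.Langlands.Langlands.Theorems.PhantomRMJunctionOfPieces

end
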